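import Summits.Ventures.CertifiedManyBodySolver.Downfold.EmeryOrbitalWeightCheck
import HarnessLib

/-!
# The Cu-d weight of the ANTINODAL Fermi-surface Bloch state in closed form, and its doping lever as a THEOREM:
# `w_face(ε) = t_pd²E(E + 4g)²/(t_pd²E(E + 4g)² + εE²(t_pd² − t_pp′ε) + 8fsN·(εE − 2(t_pd² − t_pp′ε)))`, `E = Δ + ε`, `g = t_pp + t_pp′`, is strictly DECREASING in the
# Fermi energy on the whole face window of every charge-transfer σ model — hole doping makes the antinodal state more Cu-like

Venture CertifiedManyBodySolver, cell `pub/hubbard-downfold` (stage S1; INFLATION-RULES-3to1-B §B.23 «INFL-3to1 by sign of doping», §B.72 (b′)/(f) the certified doping lever of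
the Fermi-surface weight — there a per-row KERNEL DECISION on 34/34 + 5/5 σ sets — and §B.73 (this file): the antinodal lever for EVERY σ set), seat hubbard-downfold-mod-4
(technique B, g29); namespace `Summit.Ventures.CertifiedManyBodySolver.Downfold.Emery`. Sequel of `EmeryOrbitalWeight` (`dWeight = minorD/(minorD + minorX + minorY)`),
`EmeryOrbitalWeightCheck` (`yFace = (cA − 4fsD)/(4fsD + 16fsN)`, `minorX_add_minorY`) and companion of `EmeryOrbitalWeightNode` (the nodal lever `dWeightNode_strictAnti`).
Everything PROVED (0 sorry; elementary algebra — cofactor expansion on the zone face, the linear face equation, sign bookkeeping on the window).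
WHAT THIS IS NOT: a statement about any material; `U = 0` one-body kinematics of the σ model as printed; not a cRPA/screening statement.

* §1 CLOSED FORM. On the zone face `x = sin²(k_x/2) = 1` the cofactor expansion along the `d` row reads `ε·minorD(1, y) = charCubic(1, y) + 4t_pd²[E(1 + y) + 8gy]`
  (`eps_mul_minorD_face`); at the face point `y = yFace(ε)` of the `ε`-contour (a LINEAR equation, the contour being bilinear) this gives, after clearing the face
  denominator `F = 4fsD + 16fsN`, the two identities `F·ε·minorD = 4t_pd²·ε·faceN` (`faceDen_mul_minorD`) and `F·(minorX + minorY) = 4·faceR` (`faceDen_mul_minorXY`) with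
  `faceN = E(E + 4g)²`, `faceR = εE²(t_pd² − t_pp′ε) + 8fsN(εE − 2(t_pd² − t_pp′ε))`; hence **`dWeightFace(ε) = t_pd²faceN/(t_pd²faceN + faceR)`** (`dWeightFace_eq`) — no `y`, no
  square root — and the face energy denominator is `F·ε·∂_ε charCubic(1, yFace) = 4ε(t_pd²faceN + faceR)` (`faceDen_mul_dcharCubic`).
* §2 THE FACE WINDOW. The contour reaches the zone face inside the zone iff `0 ≤ yFace ≤ 1`, i.e. `4fsD ≤ cA` (⇔ `faceG = εE + 4t_pp′ε − 4t_pd² ≥ 0`, `cA − 4fsD = E·faceG`) and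
  `cA ≤ 8fsD + 16fsN`; on it (with `fsD > 0`, `0 ≤ t_pp′ ≤ t_pp`, `ε > 0`, `Δ + ε > 0`) `faceR > 0`, so `t_pd²faceN + faceR > 0`, the face energy denominator is POSITIVE
  (`dcharCubic_face_pos` — a hypothesis of `dwCheck`/`dWeight_mem_uIcc_of_contour` discharged) and `0 < dWeightFace < 1` (`dWeightFace_mem_Ioo`).
* §3–§4 (sequel `EmeryOrbitalWeightFaceLever`): the identity `faceN(ε₁)·faceR(ε₂) − faceN(ε₂)·faceR(ε₁) = (ε₂ − ε₁)·faceCert` with an explicit positively-weighted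
  certificate polynomial in the window forms, and **THE LEVER** `dWeightFace_strictAnti`: on the face window `dWeightFace` is strictly DECREASING in `ε` — hole doping
  raises the antinodal Cu-d weight, electron doping lowers it, for every σ set in the regime (`Δ > 0`, `0 ≤ t_pp′ ≤ t_pp`, `t_pd ≠ 0`).

Sources: three-band model [HybertsenSchluterChristensen1989, Eq. (1)]; bilinear contour [AndersenEtAl1995, §6]; Positivstellensatz/Handelman certificates [folklore]
(Handelman 1988, Pac. J. Math. 132); [folklore] algebra.
-/

noncomputable section

namespace Summit.Ventures.CertifiedManyBodySolver.Downfold.Emery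

open Real Set

/-! ## §1 The antinodal d-weight as a rational function of the Fermi energy alone -/

/-- The d-sector factor of the antinodal weight: `faceN = E·(E + 4g)²`, `E = Δ + ε`, `g = t_pp + t_pp′`. [folklore] -/
def faceN (Δ tpp c ε : ℝ) : ℝ := (Δ + ε) * ((Δ + ε) + 4 * (tpp + c)) ^ 2

/-- The O-sector factor of the antinodal weight: `faceR = εE²(t_pd² − t_pp′ε) + 8·fsN·(εE − 2(t_pd² − t_pp′ε))`. [folklore] -/
def faceR (Δ tpd tpp c ε : ℝ) : ℝ :=
  ε * (Δ + ε) ^ 2 * (tpd ^ 2 - c * ε) + 8 * fsN tpd tpp c ε * (ε * (Δ + ε) - 2 * (tpd ^ 2 - c * ε))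

/-- **The Cu-d weight of the ANTINODAL Bloch state of the `ε`-contour**, `w_d(1, yFace(ε); ε)` (a function of the energy alone). [folklore] -/
def dWeightFace (Δ tpd tpp c ε : ℝ) : ℝ := dWeight Δ tpd tpp c 1 (yFace Δ tpd tpp c ε) ε

/-- Cofactor expansion along the `d` row ON THE ZONE FACE `x = 1`: `ε·minorD(1, y) = charCubic(1, y) + 4t_pd²[E(1 + y) + 8g·y]`. [folklore] -/
theorem eps_mul_minorD_face (Δ tpd tpp c y ε : ℝ) :
    ε * minorD Δ tpp c 1 y ε = charCubic Δ tpd tpp c 1 y ε + 4 * tpd ^ 2 * ((Δ + ε) * (1 + y) + 8 * (tpp + c) * y) := by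
  unfold minorD charCubic
  ring

/-- `yFace·(4fsD + 16fsN) = cA − 4fsD`. [folklore] -/
theorem yFace_mul_faceDen {Δ tpd tpp c ε : ℝ} (hF : 4 * fsD Δ tpd c ε + 16 * fsN tpd tpp c ε ≠ 0) :
    yFace Δ tpd tpp c ε * (4 * fsD Δ tpd c ε + 16 * fsN tpd tpp c ε) = cA Δ ε - 4 * fsD Δ tpd c ε := by
  unfold yFace
  field_simp

/-- **d-SECTOR IDENTITY ON THE FACE**: `(4fsD + 16fsN)·ε·minorD(1, yFace) = 4t_pd²·ε·faceN`. [folklore] -/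
theorem faceDen_mul_minorD {Δ tpd tpp c ε : ℝ} (hF : 4 * fsD Δ tpd c ε + 16 * fsN tpd tpp c ε ≠ 0) :
    (4 * fsD Δ tpd c ε + 16 * fsN tpd tpp c ε) * (ε * minorD Δ tpp c 1 (yFace Δ tpd tpp c ε) ε) =
      4 * tpd ^ 2 * ε * faceN Δ tpp c ε := by
  have hy := yFace_mul_faceDen hF
  rw [eps_mul_minorD_face Δ tpd tpp c, charCubic_yFace hF, zero_add]
  set y := yFace Δ tpd tpp c ε
  have e : (4 * fsD Δ tpd c ε + 16 * fsN tpd tpp c ε) * (4 * tpd ^ 2 * ((Δ + ε) * (1 + y) + 8 * (tpp + c) * y)) =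
      4 * tpd ^ 2 * ((Δ + ε) * ((4 * fsD Δ tpd c ε + 16 * fsN tpd tpp c ε) + y * (4 * fsD Δ tpd c ε + 16 * fsN tpd tpp c ε))
        + 8 * (tpp + c) * (y * (4 * fsD Δ tpd c ε + 16 * fsN tpd tpp c ε))) := by ring
  rw [e, hy]
  unfold cA fsD fsN faceN
  ring

/-- **O-SECTOR IDENTITY ON THE FACE**: `(4fsD + 16fsN)·(minorX + minorY)(1, yFace) = 4·faceR`. [folklore] -/
theorem faceDen_mul_minorXY {Δ tpd tpp c ε : ℝ} (hF : 4 * fsD Δ tpd c ε + 16 * fsN tpd tpp c ε ≠ 0) :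
    (4 * fsD Δ tpd c ε + 16 * fsN tpd tpp c ε) *
        (minorX Δ tpd c (yFace Δ tpd tpp c ε) ε + minorY Δ tpd c 1 ε) = 4 * faceR Δ tpd tpp c ε := by
  have hy := yFace_mul_faceDen hF
  rw [minorX_add_minorY]
  set y := yFace Δ tpd tpp c ε
  have e : (4 * fsD Δ tpd c ε + 16 * fsN tpd tpp c ε) * (pwA Δ ε + pwB tpd c ε * (1 + y)) =
      pwA Δ ε * (4 * fsD Δ tpd c ε + 16 * fsN tpd tpp c ε) +
        pwB tpd c ε * ((4 * fsD Δ tpd c ε + 16 * fsN tpd tpp c ε) + y * (4 * fsD Δ tpd c ε + 16 * fsN tpd tpp c ε)) := by ring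
  rw [e, hy]
  unfold faceR pwA pwB fsD1 cA fsD fsN
  ring

/-- `(4fsD + 16fsN)·ε·∂_ε charCubic(1, yFace) = 4ε·(t_pd²·faceN + faceR)` — the face energy denominator in closed form. [folklore] -/
theorem faceDen_mul_dcharCubic {Δ tpd tpp c ε : ℝ} (hF : 4 * fsD Δ tpd c ε + 16 * fsN tpd tpp c ε ≠ 0) :
    (4 * fsD Δ tpd c ε + 16 * fsN tpd tpp c ε) * (ε * dcharCubic Δ tpd tpp c 1 (yFace Δ tpd tpp c ε) ε) =
      4 * ε * (tpd ^ 2 * faceN Δ tpp c ε + faceR Δ tpd tpp c ε) := by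
  have h1 := faceDen_mul_minorD (Δ := Δ) (tpd := tpd) (tpp := tpp) (c := c) (ε := ε) hF
  have h2 := faceDen_mul_minorXY (Δ := Δ) (tpd := tpd) (tpp := tpp) (c := c) (ε := ε) hF
  rw [← sum_minors_eq_dcharCubic]
  linear_combination h1 + ε * h2

/-- **CLOSED FORM OF THE ANTINODAL d-WEIGHT**: for `ε ≠ 0`, `4fsD + 16fsN ≠ 0` and a non-zero face energy denominator,
`dWeightFace(ε) = t_pd²·faceN/(t_pd²·faceN + faceR) = t_pd²E(E + 4g)²/(t_pd²E(E + 4g)² + εE²(t_pd² − t_pp′ε) + 8fsN(εE − 2(t_pd² − t_pp′ε)))`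
— no `y`, no square root. [folklore] -/
theorem dWeightFace_eq {Δ tpd tpp c ε : ℝ} (hε : ε ≠ 0) (hF : 4 * fsD Δ tpd c ε + 16 * fsN tpd tpp c ε ≠ 0)
    (hW : dcharCubic Δ tpd tpp c 1 (yFace Δ tpd tpp c ε) ε ≠ 0) :
    dWeightFace Δ tpd tpp c ε = tpd ^ 2 * faceN Δ tpp c ε / (tpd ^ 2 * faceN Δ tpp c ε + faceR Δ tpd tpp c ε) := by
  have h1 := faceDen_mul_minorD (Δ := Δ) (tpd := tpd) (tpp := tpp) (c := c) (ε := ε) hF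
  have h2 := faceDen_mul_minorXY (Δ := Δ) (tpd := tpd) (tpp := tpp) (c := c) (ε := ε) hF
  have h3 := faceDen_mul_dcharCubic (Δ := Δ) (tpd := tpd) (tpp := tpp) (c := c) (ε := ε) hF
  have hden1 : minorD Δ tpp c 1 (yFace Δ tpd tpp c ε) ε + minorX Δ tpd c (yFace Δ tpd tpp c ε) ε + minorY Δ tpd c 1 ε ≠ 0 := by
    rw [sum_minors_eq_dcharCubic]; exact hW
  have hden2 : tpd ^ 2 * faceN Δ tpp c ε + faceR Δ tpd tpp c ε ≠ 0 := by
    intro h0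
    rw [h0, mul_zero] at h3
    rcases mul_eq_zero.1 h3 with hF0 | hεW
    · exact hF hF0
    · rcases mul_eq_zero.1 hεW with hε0 | hW0
      · exact hε hε0
      · exact hW hW0
  unfold dWeightFace dWeight
  rw [div_eq_div_iff hden1 hden2]
  set F := 4 * fsD Δ tpd c ε + 16 * fsN tpd tpp c ε
  set mD := minorD Δ tpp c 1 (yFace Δ tpd tpp c ε) ε
  set mXY := minorX Δ tpd c (yFace Δ tpd tpp c ε) ε + minorY Δ tpd c 1 ε
  have key : (ε * F) * (mD * (tpd ^ 2 * faceN Δ tpp c ε + faceR Δ tpd tpp c ε) - tpd ^ 2 * faceN Δ tpp c ε * (mD + mXY)) = 0 := by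
    have e1 : mD + mXY = mD + minorX Δ tpd c (yFace Δ tpd tpp c ε) ε + minorY Δ tpd c 1 ε := by simp only [mXY]; ring
    linear_combination (faceR Δ tpd tpp c ε) * h1 - (ε * tpd ^ 2 * faceN Δ tpp c ε) * h2
  have hεF : ε * F ≠ 0 := mul_ne_zero hε hF
  have := (mul_eq_zero.1 key).resolve_left hεF
  rw [show mD + minorX Δ tpd c (yFace Δ tpd tpp c ε) ε + minorY Δ tpd c 1 ε = mD + mXY by simp only [mXY]; ring]
  linarith


/-! ## §2 The face window and positivity on it -/

/-- The lower-edge form of the face window: `faceG = ε(Δ + ε) + 4t_pp′ε − 4t_pd²` (`cA − 4fsD = (Δ + ε)·faceG`). [folklore] -/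
def faceG (Δ tpd c ε : ℝ) : ℝ := ε * (Δ + ε) + 4 * c * ε - 4 * tpd ^ 2

/-- `cA − 4fsD = (Δ + ε)·faceG`. [folklore] -/
theorem cA_sub_four_fsD (Δ tpd c ε : ℝ) : cA Δ ε - 4 * fsD Δ tpd c ε = (Δ + ε) * faceG Δ tpd c ε := by
  unfold cA fsD faceG
  ring

/-- `8fsD + 16fsN − cA = 8E(t_pd² − t_pp′ε) + 16g(2t_pd² + (t_pp − t_pp′)ε) − εE²` (the upper-edge form, spelled out). [folklore] -/
theorem faceHi_eq (Δ tpd tpp c ε : ℝ) :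
    8 * fsD Δ tpd c ε + 16 * fsN tpd tpp c ε - cA Δ ε =
      8 * (Δ + ε) * (tpd ^ 2 - c * ε) + 16 * (c + (tpp - c) + c) * (2 * tpd ^ 2 + (tpp - c) * ε) - ε * (Δ + ε) ^ 2 := by
  unfold fsD fsN cA
  ring

/-- `fsN ≥ 0` for `0 ≤ t_pp′ ≤ t_pp`, `ε ≥ 0`. [folklore] -/
theorem fsN_nonneg {tpd tpp c ε : ℝ} (hc : 0 ≤ c) (hct : c ≤ tpp) (hε : 0 ≤ ε) : 0 ≤ fsN tpd tpp c ε := by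
  unfold fsN
  have h1 : 0 ≤ tpp ^ 2 - c ^ 2 := by nlinarith
  nlinarith [mul_nonneg hε h1, mul_nonneg (sq_nonneg tpd) (by linarith : 0 ≤ c + tpp)]

/-- `faceG` is increasing in `ε > 0`: `ε₁ ≤ ε₂ ⇒ faceG(ε₁) ≤ faceG(ε₂)` (`Δ, t_pp′ ≥ 0`, `ε₁ ≥ 0`). [folklore] -/
theorem faceG_mono {Δ tpd c ε₁ ε₂ : ℝ} (hΔ : 0 ≤ Δ) (hc : 0 ≤ c) (h1 : 0 ≤ ε₁) (h12 : ε₁ ≤ ε₂) : faceG Δ tpd c ε₁ ≤ faceG Δ tpd c ε₂ := by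
  unfold faceG
  nlinarith [mul_nonneg h1 (sub_nonneg.2 h12), mul_nonneg (h1.trans h12) (sub_nonneg.2 h12)]

/-- `0 ≤ yFace ↔ 0 ≤ faceG` when `F = 4fsD + 16fsN > 0` and `Δ + ε > 0`. [folklore] -/
theorem yFace_nonneg_iff {Δ tpd tpp c ε : ℝ} (hF : 0 < 4 * fsD Δ tpd c ε + 16 * fsN tpd tpp c ε) (hE : 0 < Δ + ε) :
    0 ≤ yFace Δ tpd tpp c ε ↔ 0 ≤ faceG Δ tpd c ε := by
  unfold yFace
  rw [div_nonneg_iff, cA_sub_four_fsD]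
  constructor
  · rintro (⟨h, -⟩ | ⟨-, h⟩)
    · exact le_of_mul_le_mul_left (a := Δ + ε) (by rw [mul_zero]; exact h) hE
    · exact absurd h (not_le.2 hF)
  · intro h; exact Or.inl ⟨mul_nonneg hE.le h, hF.le⟩

/-- `yFace ≤ 1 ↔ cA ≤ 8fsD + 16fsN` when `F > 0`. [folklore] -/
theorem yFace_le_one_iff {Δ tpd tpp c ε : ℝ} (hF : 0 < 4 * fsD Δ tpd c ε + 16 * fsN tpd tpp c ε) :
    yFace Δ tpd tpp c ε ≤ 1 ↔ cA Δ ε ≤ 8 * fsD Δ tpd c ε + 16 * fsN tpd tpp c ε := by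
  unfold yFace
  rw [div_le_one hF]
  constructor <;> intro h <;> linarith

/-- **ON THE FACE WINDOW `faceR > 0`** (`fsD > 0` i.e. `t_pp′ε < t_pd²` with `Δ + ε > 0`; `0 ≤ t_pp′ ≤ t_pp`; `ε > 0`; `faceG ≥ 0`). [folklore] -/
theorem faceR_pos {Δ tpd tpp c ε : ℝ} (hE : 0 < Δ + ε) (hc : 0 ≤ c) (hct : c ≤ tpp) (hε : 0 < ε) (hm : c * ε < tpd ^ 2)
    (hG : 0 ≤ faceG Δ tpd c ε) : 0 < faceR Δ tpd tpp c ε := by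
  unfold faceR
  unfold faceG at hG
  have hN := fsN_nonneg (tpd := tpd) hc hct hε.le
  have hm' : 0 < tpd ^ 2 - c * ε := sub_pos.2 hm
  have h2 : 0 ≤ ε * (Δ + ε) - 2 * (tpd ^ 2 - c * ε) := by nlinarith
  have h1 : 0 < ε * (Δ + ε) ^ 2 * (tpd ^ 2 - c * ε) := by positivity
  nlinarith [mul_nonneg hN h2]

/-- `faceN > 0` for `Δ + ε > 0`, `t_pp + t_pp′ ≥ 0`. [folklore] -/
theorem faceN_pos {Δ tpp c ε : ℝ} (hE : 0 < Δ + ε) (hg : 0 ≤ tpp + c) : 0 < faceN Δ tpp c ε := by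
  unfold faceN; positivity

/-- **THE FACE ENERGY DENOMINATOR IS POSITIVE ON THE WINDOW**: `0 < ∂_ε charCubic(1, yFace(ε); ε)` — the `hWa` hypothesis of `dWeight_mem_uIcc_of_contour` /
`dWeight_mem_Icc_node_face` discharged for every σ set on its face window. [folklore] -/
theorem dcharCubic_face_pos {Δ tpd tpp c ε : ℝ} (hE : 0 < Δ + ε) (hc : 0 ≤ c) (hct : c ≤ tpp) (hε : 0 < ε) (hm : c * ε < tpd ^ 2)
    (hG : 0 ≤ faceG Δ tpd c ε) : 0 < dcharCubic Δ tpd tpp c 1 (yFace Δ tpd tpp c ε) ε := by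
  have hD : 0 < fsD Δ tpd c ε := fsD_pos hE hm
  have hF : 0 < 4 * fsD Δ tpd c ε + 16 * fsN tpd tpp c ε := by have := fsN_nonneg (tpd := tpd) hc hct hε.le; positivity
  have h3 := faceDen_mul_dcharCubic (Δ := Δ) (tpd := tpd) (tpp := tpp) (c := c) (ε := ε) hF.ne'
  have hW : 0 < tpd ^ 2 * faceN Δ tpp c ε + faceR Δ tpd tpp c ε := by
    have := faceR_pos hE hc hct hε hm hG; have := faceN_pos (Δ := Δ) (ε := ε) hE (by linarith : 0 ≤ tpp + c); positivity
  have hpos : 0 < (4 * fsD Δ tpd c ε + 16 * fsN tpd tpp c ε) * (ε * dcharCubic Δ tpd tpp c 1 (yFace Δ tpd tpp c ε) ε) := by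
    rw [h3]; positivity
  have h1 : 0 < ε * dcharCubic Δ tpd tpp c 1 (yFace Δ tpd tpp c ε) ε := pos_of_mul_pos_right hpos hF.le
  exact pos_of_mul_pos_right h1 hε.le

/-- **`0 < dWeightFace < 1` ON THE WINDOW.** [folklore] -/
theorem dWeightFace_mem_Ioo {Δ tpd tpp c ε : ℝ} (hE : 0 < Δ + ε) (hc : 0 ≤ c) (hct : c ≤ tpp) (hε : 0 < ε) (htpd : tpd ≠ 0)
    (hm : c * ε < tpd ^ 2) (hG : 0 ≤ faceG Δ tpd c ε) : dWeightFace Δ tpd tpp c ε ∈ Set.Ioo (0 : ℝ) 1 := by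
  have hD : 0 < fsD Δ tpd c ε := fsD_pos hE hm
  have hF : 0 < 4 * fsD Δ tpd c ε + 16 * fsN tpd tpp c ε := by have := fsN_nonneg (tpd := tpd) hc hct hε.le; positivity
  have hR := faceR_pos hE hc hct hε hm hG
  have hNn := faceN_pos (Δ := Δ) (ε := ε) hE (by linarith : 0 ≤ tpp + c)
  have ht : 0 < tpd ^ 2 := by positivity
  rw [dWeightFace_eq hε.ne' hF.ne' (dcharCubic_face_pos hE hc hct hε hm hG).ne']
  constructor
  · positivity
  · rw [div_lt_one (by positivity)]
    linarith

end Summit.Ventures.CertifiedManyBodySolver.Downfold.Emery
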